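import Summits.CriticalPhenomena.PercolationContinuityZ3.Theorems.PercNearOneGluingNoHeavyConstsChainMinorStarPeel
import HarnessLib
import HarnessLib.Audit.Tags

/-!
# The Y-PEEL of the chain minor at one avoided vertex (Theorem J of the P2 sheet; PAPER-2 track (ii))

builds on p205010 (kernel theorem, internal audit signed; external expert review pending).  Support file (`--supports
stmt-CriticalPhenomena-4575`), seat `prim-consts-2` (gen 8); memo `run/shared/lean/prim/consts/FROM-prim-consts-2-g8-STAR-PEEL.md` §3.1.
No definitions, no named facts, no sorries; standard axioms.

* `Consts.det3_colsum` — multilinearity of the `3 × 3` determinant in its three columns, finite-sum form.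
* `Consts.starWt_eq_prod_ite`, `Consts.starWt_triple_eq_prod_profile` — the product of the three star-peel weights regrouped by the profile
  `κ(t) = #{j : t ∈ Z_j}`: `wt(Z₁)wt(Z₂)wt(Z₃) = ∏_t q_t^{κ(t)}(1−q_t)^{3−κ(t)}` (the trinomial Bernstein monomial of the Y-star table).
* `Consts.det_avoid_insert_eq_starPeel`, `Consts.det_avoid_insert_nonneg_of_starProfileSums_nonneg` — the same for ARBITRARY base targets
  `(T₁,T₂,T₃)` (the form needed to iterate the peel over several avoided vertices / extra fixed spoilers, Theorem K of the memo).
* `Consts.chainMinor_eq_starPeel` — **THEOREM J (|Y| = 1)**: for an avoided vertex `y ∉ {x,u,v}` whose pairs of nonzero weight go to a finite set `M ∌ y`,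
  the chain minor `D(G;{y})` (`Consts.singleEdgeChainRule_of_chainMinor`, p306944) equals
  `Σ_{Z₁,Z₂,Z₃ ⊆ M} wt(Z₁)wt(Z₂)wt(Z₃) · det[K⁰(S_i, A_j ∪ Z_j)]`, `wt(Z) = ∏_{t∈Z} w(yt) ∏_{t∈M∖Z} (1 − w(yt))`, `A = (∅, {o}, {v,o})`,
  `K⁰` the kernel of `w` switched off at the pairs `s(y,t)`, `t ∈ M` (three independent copies of van den Berg–Häggström–Kahn's identity (6), one per column:
  `Consts.real_avoid_insert_starPeel`, p314198).  Grouping the triple sum by the profile `κ(t) = #{j : t ∈ Z_j}` gives the Y-star Bernstein form of the memo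
  (coefficients = vertex-profile sums on `G − y`), whose positivity WOULD imply the single-edge chain rule (the memo's conjecture VP₀/Y-BERN;
  STATUS: REFUTED — ttrl3 relay 118 (exact six-vertex weighted witness, a two-spoiler member `B(1_a+1_b) < 0`), and the single-edge chain rule
  itself is false, `Consts.not_singleEdgeChainRule` (p317091, relay 119); the identities of this file are unaffected):
* `Consts.chainMinor_nonneg_of_starProfileSums_nonneg` — **COROLLARY: if every profile sum `Σ_{(Z_j) ⊆ M³ of profile κ} det[K⁰(S_i, A_j ∪ Z_j)]` is `≥ 0`,
  then `D(G;{y}) ≥ 0`** (`Finset.sum_fiberwise_of_maps_to`; the Bernstein monomials are `≥ 0`).  For `M ⊆ {x,u,v,o}` the profile sums are the local-family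
  polynomials of p309802 (combinations of `D₀, L_D, A_D₀, N₀`); in general this is the |Y| = 1 layer of the memo-level reduction "VP₀ ⟹ chain rule"
  (Theorem K of the memo), now vacuous as a route since both VP₀ and the chain rule are refuted (relays 118/119, p317091).
[cite: VandenbergHaggstromKahn2005, Thm. 1.1 proof, display (6) (pp. 4–5)] [cite: Grimmett1999, §2.2]
-/

noncomputable section

namespace Summit.CriticalPhenomena.PercolationContinuityZ3.Theorems

open MeasureTheory Set Literature.Probability.LatticeModels Literature.Probability.Percolation
open scoped Classical

namespace Consts

/-- Notation (this file only): the disconnection kernel `𝕂[w](S, T) = μ_w{S ↮ T}`. -/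
local notation3 "𝕂[" w "](" S ", " T ")" =>
  MeasureTheory.Measure.real (prodBernoulli w) {ω | ∀ s ∈ S, ∀ t ∈ T, ¬ (openGraph ω).Reachable s t}

variable {V : Type*}

/-- **Multilinearity of the `3 × 3` determinant in its columns, finite-sum form**: if column `j` is `Σ_{a ∈ s_j} f_j(a)·(column vector)`,
the determinant is the triple sum of `f₁(a)f₂(b)f₃(c) · det`. [folklore] -/
theorem det3_colsum {ι : Type*} (s₁ s₂ s₃ : Finset ι) (f₁ f₂ f₃ P₀ P₁ P₂ Q₀ Q₁ Q₂ R₀ R₁ R₂ : ι → ℝ) :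
    Matrix.det !![∑ a ∈ s₁, f₁ a * P₀ a, ∑ b ∈ s₂, f₂ b * Q₀ b, ∑ c ∈ s₃, f₃ c * R₀ c;
                  ∑ a ∈ s₁, f₁ a * P₁ a, ∑ b ∈ s₂, f₂ b * Q₁ b, ∑ c ∈ s₃, f₃ c * R₁ c;
                  ∑ a ∈ s₁, f₁ a * P₂ a, ∑ b ∈ s₂, f₂ b * Q₂ b, ∑ c ∈ s₃, f₃ c * R₂ c] =
      ∑ a ∈ s₁, ∑ b ∈ s₂, ∑ c ∈ s₃, f₁ a * f₂ b * f₃ c *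
        Matrix.det !![P₀ a, Q₀ b, R₀ c; P₁ a, Q₁ b, R₁ c; P₂ a, Q₂ b, R₂ c] := by
  simp only [Matrix.det_fin_three, Matrix.of_apply, Matrix.cons_val', Matrix.cons_val_zero, Matrix.cons_val_one,
    Matrix.cons_val_two, Matrix.empty_val', Matrix.cons_val_fin_one, Matrix.head_cons, Matrix.head_fin_const,
    Matrix.tail_cons]
  have e : ∀ (α β γ : ι → ℝ), (∑ a ∈ s₁, α a) * (∑ b ∈ s₂, β b) * (∑ c ∈ s₃, γ c) =
      ∑ a ∈ s₁, ∑ b ∈ s₂, ∑ c ∈ s₃, α a * β b * γ c := by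
    intro α β γ
    rw [Finset.sum_mul_sum, Finset.sum_mul]
    refine Finset.sum_congr rfl fun a _ => ?_
    rw [Finset.sum_mul]
    refine Finset.sum_congr rfl fun b _ => ?_
    rw [Finset.mul_sum]
  have e132 : ∀ (α β γ : ι → ℝ), (∑ a ∈ s₁, α a) * (∑ c ∈ s₃, γ c) * (∑ b ∈ s₂, β b) =
      ∑ a ∈ s₁, ∑ b ∈ s₂, ∑ c ∈ s₃, α a * β b * γ c := by
    intro α β γ; rw [mul_assoc, mul_comm (∑ c ∈ s₃, γ c), ← mul_assoc]; exact e α β γ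
  have e213 : ∀ (α β γ : ι → ℝ), (∑ b ∈ s₂, β b) * (∑ a ∈ s₁, α a) * (∑ c ∈ s₃, γ c) =
      ∑ a ∈ s₁, ∑ b ∈ s₂, ∑ c ∈ s₃, α a * β b * γ c := by
    intro α β γ; rw [mul_comm (∑ b ∈ s₂, β b)]; exact e α β γ
  have e231 : ∀ (α β γ : ι → ℝ), (∑ b ∈ s₂, β b) * (∑ c ∈ s₃, γ c) * (∑ a ∈ s₁, α a) =
      ∑ a ∈ s₁, ∑ b ∈ s₂, ∑ c ∈ s₃, α a * β b * γ c := by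
    intro α β γ; rw [mul_comm, ← mul_assoc]; exact e α β γ
  have e312 : ∀ (α β γ : ι → ℝ), (∑ c ∈ s₃, γ c) * (∑ a ∈ s₁, α a) * (∑ b ∈ s₂, β b) =
      ∑ a ∈ s₁, ∑ b ∈ s₂, ∑ c ∈ s₃, α a * β b * γ c := by
    intro α β γ; rw [mul_comm (∑ c ∈ s₃, γ c), mul_assoc, mul_comm (∑ c ∈ s₃, γ c), ← mul_assoc]; exact e α β γ
  have e321 : ∀ (α β γ : ι → ℝ), (∑ c ∈ s₃, γ c) * (∑ b ∈ s₂, β b) * (∑ a ∈ s₁, α a) =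
      ∑ a ∈ s₁, ∑ b ∈ s₂, ∑ c ∈ s₃, α a * β b * γ c := by
    intro α β γ; rw [mul_comm, mul_comm (∑ c ∈ s₃, γ c), ← mul_assoc]; exact e α β γ
  rw [e, e132, e213, e231, e312, e321]
  simp only [← Finset.sum_sub_distrib, ← Finset.sum_add_distrib]
  refine Finset.sum_congr rfl fun a _ => Finset.sum_congr rfl fun b _ => Finset.sum_congr rfl fun c _ => ?_
  ring

/-- The star-peel weight of `Z ⊆ M` as a single product over `M`. [folklore] -/
theorem starWt_eq_prod_ite [DecidableEq V] (M Z : Finset V) (hZ : Z ⊆ M) (q : V → ℝ) :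
    (∏ t ∈ Z, q t) * (∏ t ∈ M \ Z, (1 - q t)) = ∏ t ∈ M, (if t ∈ Z then q t else 1 - q t) := by
  rw [← Finset.prod_sdiff hZ, mul_comm]
  congr 1
  · exact Finset.prod_congr rfl fun t ht => by rw [if_neg (Finset.mem_sdiff.1 ht).2]
  · exact Finset.prod_congr rfl fun t ht => by rw [if_pos ht]

/-- **Regrouping of the three star-peel weights by the profile** `κ(t) = [t∈Z₁]+[t∈Z₂]+[t∈Z₃]`:
`wt(Z₁)wt(Z₂)wt(Z₃) = ∏_{t∈M} q_t^{κ(t)} (1−q_t)^{3−κ(t)}` (the second exponent written as a sum of complements, no truncated subtraction). [folklore] -/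
theorem starWt_triple_eq_prod_profile [DecidableEq V] (M Z₁ Z₂ Z₃ : Finset V) (h₁ : Z₁ ⊆ M) (h₂ : Z₂ ⊆ M) (h₃ : Z₃ ⊆ M)
    (q : V → ℝ) :
    ((∏ t ∈ Z₁, q t) * ∏ t ∈ M \ Z₁, (1 - q t)) * ((∏ t ∈ Z₂, q t) * ∏ t ∈ M \ Z₂, (1 - q t)) *
        ((∏ t ∈ Z₃, q t) * ∏ t ∈ M \ Z₃, (1 - q t)) =
      ∏ t ∈ M, q t ^ ((if t ∈ Z₁ then 1 else 0) + (if t ∈ Z₂ then 1 else 0) + (if t ∈ Z₃ then 1 else 0)) *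
        (1 - q t) ^ ((if t ∈ Z₁ then 0 else 1) + (if t ∈ Z₂ then 0 else 1) + (if t ∈ Z₃ then 0 else 1)) := by
  rw [starWt_eq_prod_ite M Z₁ h₁ q, starWt_eq_prod_ite M Z₂ h₂ q, starWt_eq_prod_ite M Z₃ h₃ q, ← Finset.prod_mul_distrib,
    ← Finset.prod_mul_distrib]
  refine Finset.prod_congr rfl fun t _ => ?_
  by_cases a : t ∈ Z₁ <;> by_cases b : t ∈ Z₂ <;> by_cases c : t ∈ Z₃ <;> simp only [a, b, c, ite_true, ite_false] <;> ring



variable [Fintype V]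

/-- **The star peel of a source-chain minor with arbitrary base targets** (three copies, one per column):
`det[K_w(S_i, T_j ∪ {y})] = Σ_{Z₁,Z₂,Z₃ ⊆ M} wt(Z₁)wt(Z₂)wt(Z₃) · det[K⁰(S_i, T_j ∪ Z_j)]` for `S = (x, xu, xuv)`, `y ∉ {x,u,v} ∪ M`, all pairs at `y`
outside `M` of weight `0`. [cite: VandenbergHaggstromKahn2005, Thm. 1.1 proof, display (6) (pp. 4–5)] -/
theorem det_avoid_insert_eq_starPeel (w : Sym2 V → unitInterval) (x u v y : V) (M : Finset V) (hyM : y ∉ M)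
    (hyx : y ≠ x) (hyu : y ≠ u) (hyv : y ≠ v) (hsupp : ∀ t, t ≠ y → t ∉ M → w s(y, t) = 0)
    (F : Set (Sym2 V)) (hF : F = ((M.image fun t => s(y, t)) : Set (Sym2 V)))
    (wF : Sym2 V → unitInterval) (hwF : wF = fun e => if e ∈ F then 0 else w e) (T₁ T₂ T₃ : Set V) :
    Matrix.det !![𝕂[w](({x} : Set V), insert y T₁), 𝕂[w](({x} : Set V), insert y T₂), 𝕂[w](({x} : Set V), insert y T₃);
      𝕂[w](({x, u} : Set V), insert y T₁), 𝕂[w](({x, u} : Set V), insert y T₂), 𝕂[w](({x, u} : Set V), insert y T₃);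
      𝕂[w](({x, u, v} : Set V), insert y T₁), 𝕂[w](({x, u, v} : Set V), insert y T₂), 𝕂[w](({x, u, v} : Set V), insert y T₃)] =
    ∑ Z1 ∈ M.powerset, ∑ Z2 ∈ M.powerset, ∑ Z3 ∈ M.powerset,
        ((∏ t ∈ Z1, (w s(y, t) : ℝ)) * (∏ t ∈ M \ Z1, (1 - (w s(y, t) : ℝ)))) * ((∏ t ∈ Z2, (w s(y, t) : ℝ)) * (∏ t ∈ M \ Z2, (1 - (w s(y, t) : ℝ)))) * ((∏ t ∈ Z3, (w s(y, t) : ℝ)) * (∏ t ∈ M \ Z3, (1 - (w s(y, t) : ℝ)))) *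
        Matrix.det !![𝕂[wF](({x} : Set V), T₁ ∪ (Z1 : Set V)), 𝕂[wF](({x} : Set V), T₂ ∪ (Z2 : Set V)), 𝕂[wF](({x} : Set V), T₃ ∪ (Z3 : Set V));
          𝕂[wF](({x, u} : Set V), T₁ ∪ (Z1 : Set V)), 𝕂[wF](({x, u} : Set V), T₂ ∪ (Z2 : Set V)), 𝕂[wF](({x, u} : Set V), T₃ ∪ (Z3 : Set V));
          𝕂[wF](({x, u, v} : Set V), T₁ ∪ (Z1 : Set V)), 𝕂[wF](({x, u, v} : Set V), T₂ ∪ (Z2 : Set V)), 𝕂[wF](({x, u, v} : Set V), T₃ ∪ (Z3 : Set V))] := by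
  have hy1 : y ∉ ({x} : Set V) := fun h => hyx (mem_singleton_iff.1 h)
  have hy2 : y ∉ ({x, u} : Set V) := by simp only [mem_insert_iff, mem_singleton_iff, not_or]; exact ⟨hyx, hyu⟩
  have hy3 : y ∉ ({x, u, v} : Set V) := by simp only [mem_insert_iff, mem_singleton_iff, not_or]; exact ⟨hyx, hyu, hyv⟩
  have P := fun (S : Set V) (hyS : y ∉ S) (T₀ : Set V) => real_avoid_insert_starPeel w S T₀ y M hyM hyS hsupp F hF
  rw [P _ hy1 T₁, P _ hy1 T₂, P _ hy1 T₃, P _ hy2 T₁, P _ hy2 T₂, P _ hy2 T₃, P _ hy3 T₁, P _ hy3 T₂, P _ hy3 T₃, ← hwF]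
  rw [det3_colsum]

/-- **COROLLARY (profile form): if every profile sum `Σ_{(Z_j) ⊆ M³ of profile κ} det[K⁰(S_i, T_j ∪ Z_j)]` is nonnegative, so is `det[K_w(S_i, T_j ∪ {y})]`**
— the weight of a triple is the Bernstein monomial of its profile (`Consts.starWt_triple_eq_prod_profile`), group by profile
(`Finset.sum_fiberwise_of_maps_to`). [cite: VandenbergHaggstromKahn2005, Thm. 1.1 proof, display (6) (pp. 4–5)] -/
theorem det_avoid_insert_nonneg_of_starProfileSums_nonneg (w : Sym2 V → unitInterval) (x u v y : V) (M : Finset V) (hyM : y ∉ M)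
    (hyx : y ≠ x) (hyu : y ≠ u) (hyv : y ≠ v) (hsupp : ∀ t, t ≠ y → t ∉ M → w s(y, t) = 0)
    (F : Set (Sym2 V)) (hF : F = ((M.image fun t => s(y, t)) : Set (Sym2 V)))
    (wF : Sym2 V → unitInterval) (hwF : wF = fun e => if e ∈ F then 0 else w e) (T₁ T₂ T₃ : Set V)
    (hpos : ∀ κ : V → ℕ, 0 ≤ ∑ q ∈ ((M.powerset ×ˢ M.powerset) ×ˢ M.powerset) with
        (fun t => (if t ∈ q.1.1 then 1 else 0) + (if t ∈ q.1.2 then 1 else 0) + (if t ∈ q.2 then 1 else 0)) = κ,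
          Matrix.det !![𝕂[wF](({x} : Set V), T₁ ∪ (q.1.1 : Set V)), 𝕂[wF](({x} : Set V), T₂ ∪ (q.1.2 : Set V)), 𝕂[wF](({x} : Set V), T₃ ∪ (q.2 : Set V));
            𝕂[wF](({x, u} : Set V), T₁ ∪ (q.1.1 : Set V)), 𝕂[wF](({x, u} : Set V), T₂ ∪ (q.1.2 : Set V)), 𝕂[wF](({x, u} : Set V), T₃ ∪ (q.2 : Set V));
            𝕂[wF](({x, u, v} : Set V), T₁ ∪ (q.1.1 : Set V)), 𝕂[wF](({x, u, v} : Set V), T₂ ∪ (q.1.2 : Set V)), 𝕂[wF](({x, u, v} : Set V), T₃ ∪ (q.2 : Set V))]) :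
    0 ≤ Matrix.det !![𝕂[w](({x} : Set V), insert y T₁), 𝕂[w](({x} : Set V), insert y T₂), 𝕂[w](({x} : Set V), insert y T₃);
      𝕂[w](({x, u} : Set V), insert y T₁), 𝕂[w](({x, u} : Set V), insert y T₂), 𝕂[w](({x, u} : Set V), insert y T₃);
      𝕂[w](({x, u, v} : Set V), insert y T₁), 𝕂[w](({x, u, v} : Set V), insert y T₂), 𝕂[w](({x, u, v} : Set V), insert y T₃)] := by
  classical
  rw [det_avoid_insert_eq_starPeel w x u v y M hyM hyx hyu hyv hsupp F hF wF hwF T₁ T₂ T₃]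
  set P := M.powerset with hP
  set q_ : V → ℝ := fun t => (w s(y, t) : ℝ) with hq
  set prof : (Finset V × Finset V) × Finset V → V → ℕ :=
    fun q t => (if t ∈ q.1.1 then 1 else 0) + (if t ∈ q.1.2 then 1 else 0) + (if t ∈ q.2 then 1 else 0) with hprof
  set bern : (V → ℕ) → ℝ := fun κ => ∏ t ∈ M, q_ t ^ κ t * (1 - q_ t) ^ (3 - κ t) with hbern
  set DET : (Finset V × Finset V) × Finset V → ℝ := fun q =>
    Matrix.det !![𝕂[wF](({x} : Set V), T₁ ∪ (q.1.1 : Set V)), 𝕂[wF](({x} : Set V), T₂ ∪ (q.1.2 : Set V)), 𝕂[wF](({x} : Set V), T₃ ∪ (q.2 : Set V));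
            𝕂[wF](({x, u} : Set V), T₁ ∪ (q.1.1 : Set V)), 𝕂[wF](({x, u} : Set V), T₂ ∪ (q.1.2 : Set V)), 𝕂[wF](({x, u} : Set V), T₃ ∪ (q.2 : Set V));
            𝕂[wF](({x, u, v} : Set V), T₁ ∪ (q.1.1 : Set V)), 𝕂[wF](({x, u, v} : Set V), T₂ ∪ (q.1.2 : Set V)), 𝕂[wF](({x, u, v} : Set V), T₃ ∪ (q.2 : Set V))] with hDET
  have e1 : (∑ Z1 ∈ M.powerset, ∑ Z2 ∈ M.powerset, ∑ Z3 ∈ M.powerset,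
      ((∏ t ∈ Z1, (w s(y, t) : ℝ)) * (∏ t ∈ M \ Z1, (1 - (w s(y, t) : ℝ)))) * ((∏ t ∈ Z2, (w s(y, t) : ℝ)) * (∏ t ∈ M \ Z2, (1 - (w s(y, t) : ℝ)))) * ((∏ t ∈ Z3, (w s(y, t) : ℝ)) * (∏ t ∈ M \ Z3, (1 - (w s(y, t) : ℝ)))) *
      Matrix.det !![𝕂[wF](({x} : Set V), T₁ ∪ (Z1 : Set V)), 𝕂[wF](({x} : Set V), T₂ ∪ (Z2 : Set V)), 𝕂[wF](({x} : Set V), T₃ ∪ (Z3 : Set V));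
          𝕂[wF](({x, u} : Set V), T₁ ∪ (Z1 : Set V)), 𝕂[wF](({x, u} : Set V), T₂ ∪ (Z2 : Set V)), 𝕂[wF](({x, u} : Set V), T₃ ∪ (Z3 : Set V));
          𝕂[wF](({x, u, v} : Set V), T₁ ∪ (Z1 : Set V)), 𝕂[wF](({x, u, v} : Set V), T₂ ∪ (Z2 : Set V)), 𝕂[wF](({x, u, v} : Set V), T₃ ∪ (Z3 : Set V))]) =
      ∑ q ∈ (P ×ˢ P) ×ˢ P, bern (prof q) * DET q := by
    rw [Finset.sum_product, Finset.sum_product]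
    refine Finset.sum_congr rfl fun Z1 h1 => Finset.sum_congr rfl fun Z2 h2 => Finset.sum_congr rfl fun Z3 h3 => ?_
    have hw := starWt_triple_eq_prod_profile M Z1 Z2 Z3 (Finset.mem_powerset.1 h1) (Finset.mem_powerset.1 h2)
      (Finset.mem_powerset.1 h3) q_
    simp only [hq] at hw
    rw [hw, hbern, hDET]
    congr 1
    refine Finset.prod_congr rfl fun t _ => ?_
    have hc : 3 - prof ((Z1, Z2), Z3) t = (if t ∈ Z1 then 0 else 1) + (if t ∈ Z2 then 0 else 1) + (if t ∈ Z3 then 0 else 1) := by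
      simp only [hprof]
      by_cases a : t ∈ Z1 <;> by_cases b : t ∈ Z2 <;> by_cases c : t ∈ Z3 <;> simp [a, b, c]
    rw [hc]
  rw [e1, ← Finset.sum_fiberwise_of_maps_to (s := (P ×ˢ P) ×ˢ P) (t := ((P ×ˢ P) ×ˢ P).image prof) (g := prof)
    (fun q hq => Finset.mem_image_of_mem prof hq)]
  refine Finset.sum_nonneg fun κ _ => ?_
  have hfib : ∑ q ∈ (P ×ˢ P) ×ˢ P with prof q = κ, bern (prof q) * DET q = bern κ * ∑ q ∈ (P ×ˢ P) ×ˢ P with prof q = κ, DET q := by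
    rw [Finset.mul_sum]
    refine Finset.sum_congr rfl fun q hq => ?_
    rw [(Finset.mem_filter.1 hq).2]
  rw [hfib]
  refine mul_nonneg ?_ ?_
  · refine Finset.prod_nonneg fun t _ => mul_nonneg (pow_nonneg (w s(y, t)).2.1 _) (pow_nonneg ?_ _)
    simp only [hq]; linarith [(w s(y, t)).2.2]
  · have := hpos κ
    simpa only [hP, hprof, hDET] using this

/-- **THEOREM J (the Y-peel of the chain minor at one avoided vertex).**  See the file header.
[cite: VandenbergHaggstromKahn2005, Thm. 1.1 proof, display (6) (pp. 4–5)] -/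
theorem chainMinor_eq_starPeel (w : Sym2 V → unitInterval) (x u v o y : V) (M : Finset V) (hyM : y ∉ M)
    (hyx : y ≠ x) (hyu : y ≠ u) (hyv : y ≠ v) (hsupp : ∀ t, t ≠ y → t ∉ M → w s(y, t) = 0)
    (F : Set (Sym2 V)) (hF : F = ((M.image fun t => s(y, t)) : Set (Sym2 V)))
    (wF : Sym2 V → unitInterval) (hwF : wF = fun e => if e ∈ F then 0 else w e) :
    Matrix.det !![
      𝕂[w](({x} : Set V), ({y} : Set V)), 𝕂[w](({x} : Set V), insert o ({y} : Set V)), 𝕂[w](({x} : Set V), insert v (insert o ({y} : Set V)));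
      𝕂[w](({x, u} : Set V), ({y} : Set V)), 𝕂[w](({x, u} : Set V), insert o ({y} : Set V)), 𝕂[w](({x, u} : Set V), insert v (insert o ({y} : Set V)));
      𝕂[w](({x, u, v} : Set V), ({y} : Set V)), 𝕂[w](({x, u, v} : Set V), insert o ({y} : Set V)),
        𝕂[w](({x, u, v} : Set V), insert v (insert o ({y} : Set V)))] =
    ∑ Z1 ∈ M.powerset, ∑ Z2 ∈ M.powerset, ∑ Z3 ∈ M.powerset,
        ((∏ t ∈ Z1, (w s(y, t) : ℝ)) * (∏ t ∈ M \ Z1, (1 - (w s(y, t) : ℝ)))) * ((∏ t ∈ Z2, (w s(y, t) : ℝ)) * (∏ t ∈ M \ Z2, (1 - (w s(y, t) : ℝ)))) * ((∏ t ∈ Z3, (w s(y, t) : ℝ)) * (∏ t ∈ M \ Z3, (1 - (w s(y, t) : ℝ)))) *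
        Matrix.det !![𝕂[wF](({x} : Set V), (∅ : Set V) ∪ (Z1 : Set V)), 𝕂[wF](({x} : Set V), ({o} : Set V) ∪ (Z2 : Set V)), 𝕂[wF](({x} : Set V), ({v, o} : Set V) ∪ (Z3 : Set V));
          𝕂[wF](({x, u} : Set V), (∅ : Set V) ∪ (Z1 : Set V)), 𝕂[wF](({x, u} : Set V), ({o} : Set V) ∪ (Z2 : Set V)), 𝕂[wF](({x, u} : Set V), ({v, o} : Set V) ∪ (Z3 : Set V));
          𝕂[wF](({x, u, v} : Set V), (∅ : Set V) ∪ (Z1 : Set V)), 𝕂[wF](({x, u, v} : Set V), ({o} : Set V) ∪ (Z2 : Set V)), 𝕂[wF](({x, u, v} : Set V), ({v, o} : Set V) ∪ (Z3 : Set V))] := by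
  have h3 : (insert v (insert o ({y} : Set V)) : Set V) = insert y ({v, o} : Set V) := by
    ext a; simp only [mem_insert_iff, mem_singleton_iff]; tauto
  have h2 : (insert o ({y} : Set V) : Set V) = insert y ({o} : Set V) := Set.pair_comm _ _
  have h1 : ({y} : Set V) = insert y (∅ : Set V) := Set.singleton_def y
  rw [h3, h2, h1]
  exact det_avoid_insert_eq_starPeel w x u v y M hyM hyx hyu hyv hsupp F hF wF hwF ∅ {o} {v, o}

/-- **COROLLARY (Y-star Bernstein form ⟹ the chain minor): if every PROFILE SUM of the star peel is nonnegative, so is `D(G;{y})`.**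
For `κ : V → ℕ` the profile sum is `Σ det[K⁰(S_i, A_j ∪ Z_j)]` over the triples `(Z₁,Z₂,Z₃)` of subsets of `M` with `#{j : t ∈ Z_j} = κ(t)` for all `t`
(the vertex-profile sum `B_{G−y}(κ)` of the memo, §3); `D(G;{y}) = Σ_κ Bern_κ(q) · B(κ) ≥ 0`.  (Conjecture VP₀/Y-BERN of the memo said the hypothesis
always holds — REFUTED by an exact six-vertex witness, ttrl3 relay 118, consistent with `Consts.not_singleEdgeChainRule` (p317091); the corollary stays
valid as an implication and is the tool for the graphs on which the profile sums ARE nonnegative, e.g. the local family of p309802.)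
[cite: VandenbergHaggstromKahn2005, Thm. 1.1 proof, display (6) (pp. 4–5)] -/
theorem chainMinor_nonneg_of_starProfileSums_nonneg (w : Sym2 V → unitInterval) (x u v o y : V) (M : Finset V) (hyM : y ∉ M)
    (hyx : y ≠ x) (hyu : y ≠ u) (hyv : y ≠ v) (hsupp : ∀ t, t ≠ y → t ∉ M → w s(y, t) = 0)
    (F : Set (Sym2 V)) (hF : F = ((M.image fun t => s(y, t)) : Set (Sym2 V)))
    (wF : Sym2 V → unitInterval) (hwF : wF = fun e => if e ∈ F then 0 else w e)
    (hpos : ∀ κ : V → ℕ, 0 ≤ ∑ q ∈ ((M.powerset ×ˢ M.powerset) ×ˢ M.powerset) with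
        (fun t => (if t ∈ q.1.1 then 1 else 0) + (if t ∈ q.1.2 then 1 else 0) + (if t ∈ q.2 then 1 else 0)) = κ,
          Matrix.det !![𝕂[wF](({x} : Set V), (∅ : Set V) ∪ (q.1.1 : Set V)), 𝕂[wF](({x} : Set V), ({o} : Set V) ∪ (q.1.2 : Set V)), 𝕂[wF](({x} : Set V), ({v, o} : Set V) ∪ (q.2 : Set V));
            𝕂[wF](({x, u} : Set V), (∅ : Set V) ∪ (q.1.1 : Set V)), 𝕂[wF](({x, u} : Set V), ({o} : Set V) ∪ (q.1.2 : Set V)), 𝕂[wF](({x, u} : Set V), ({v, o} : Set V) ∪ (q.2 : Set V));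
            𝕂[wF](({x, u, v} : Set V), (∅ : Set V) ∪ (q.1.1 : Set V)), 𝕂[wF](({x, u, v} : Set V), ({o} : Set V) ∪ (q.1.2 : Set V)), 𝕂[wF](({x, u, v} : Set V), ({v, o} : Set V) ∪ (q.2 : Set V))]) :
    0 ≤ Matrix.det !![
      𝕂[w](({x} : Set V), ({y} : Set V)), 𝕂[w](({x} : Set V), insert o ({y} : Set V)), 𝕂[w](({x} : Set V), insert v (insert o ({y} : Set V)));
      𝕂[w](({x, u} : Set V), ({y} : Set V)), 𝕂[w](({x, u} : Set V), insert o ({y} : Set V)), 𝕂[w](({x, u} : Set V), insert v (insert o ({y} : Set V)));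
      𝕂[w](({x, u, v} : Set V), ({y} : Set V)), 𝕂[w](({x, u, v} : Set V), insert o ({y} : Set V)),
        𝕂[w](({x, u, v} : Set V), insert v (insert o ({y} : Set V)))] := by
  have h3 : (insert v (insert o ({y} : Set V)) : Set V) = insert y ({v, o} : Set V) := by
    ext a; simp only [mem_insert_iff, mem_singleton_iff]; tauto
  have h2 : (insert o ({y} : Set V) : Set V) = insert y ({o} : Set V) := Set.pair_comm _ _
  have h1 : ({y} : Set V) = insert y (∅ : Set V) := Set.singleton_def y
  rw [h3, h2, h1]
  exact det_avoid_insert_nonneg_of_starProfileSums_nonneg w x u v y M hyM hyx hyu hyv hsupp F hF wF hwF ∅ {o} {v, o} hpos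

end Consts

end Summit.CriticalPhenomena.PercolationContinuityZ3.Theorems

end
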